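import Mathlib
import HarnessLib
import Summits.NavierStokesRegularity.NavierStokesRegularity.Theorems.HalfSpaceWindowDoorCirculationCarryingRigidityParabolicConfinement
import Summits.NavierStokesRegularity.NavierStokesRegularity.Theorems.HalfSpaceWindowDoorCirculationCarryingRigidityMovingFrame

/-!
# Route `HalfSpaceWindowDoor`, crux `CirculationCarryingRigidity` (stmt-NavierStokesRegularity-25311) — line `eddy_covariance`,
# PARABOLIC CONFINEMENT ABOUT A MOVING AXIS ⇒ POLOIDAL

LEAD ns-hsw-p1 g10, `--supports 25311 --as helper`; card `Cruxes/…/Lines/eddy_covariance.md`.  This is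
`…ParabolicConfinement.inner_curl_e3_eq_zero_of_confined` for the moving profile `W(t,x) = v(t, x + √(−t)y₀)` of `…MovingFrame`: if in a
far-past epoch `s ≤ σ₀` every disc circulation of `W` (discs centred on the axis `x_h = √(−s)y₀`) is `≤ S₀`, and `S₀` is approached by the
tube-boundary discs `D(R₁√(−s), z)` of the epoch, then `v` is POLOIDAL.  The point of the moving frame: the parabolic ZOOMS about axis points
commute with it — `λ·W(λ²s, (0,0,ζ) + λy) = (λ·v(λ²·, (0,0,ζ) + λ·))(s, y + √(−s)y₀)` — so the blow-down argument of the fixed-axis file runs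
verbatim: zooms of `v` (door class, compact), read through the moving frame, converge to the moving-frame view of a door-class limit, whose
time `−1` slice is a FIXED translate of a door-class slice; plane saturation rigidity (`…TransportRigidity`) finishes.
WHAT THIS IS NOT: not about NS regularity; HYPOTHETICAL blow-up profiles (KNSS ancient mild solutions).  No item is closed here.
-/

noncomputable section

-- the summit and its single sub-problem share the name (CONVENTIONS §1), as in every Theorems file
set_option linter.dupNamespace false

namespace Summit.NavierStokesRegularity.NavierStokesRegularity.Theorems.HalfSpaceWindowDoorCirculationCarryingRigidityMovingConfinement

open MeasureTheory Set Function Filter Topology InnerProductSpace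
open scoped RealInnerProductSpace InnerProductSpace
open Literature.Analysis Literature.Analysis.UnboundedOperators
open Literature.Analysis.FluidPDE hiding eR
open Summit.NavierStokesRegularity.NavierStokesRegularity.Theorems.HalfSpaceWindowDoorCirculationCarryingRigidityDefs
  (InDoorClass SignE3 e3)
open Summit.NavierStokesRegularity.NavierStokesRegularity.Theorems.AxisTwistDoorAveragedConeLiouvilleDefs (cylPt eT circ)
open Summit.NavierStokesRegularity.NavierStokesRegularity.Theorems.AveragedConeLiouville.CircleLimits (tendsto_circ)
open Summit.NavierStokesRegularity.NavierStokesRegularity.Theorems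
  (exists_tendsto_of_isTypeIAncientMild_seq isTypeIAncientMild_zoom zoom_apply)
open Summit.NavierStokesRegularity.NavierStokesRegularity.Theorems.HalfSpaceWindowDoorCirculationCarryingRigidityGaussExtremal
  (inDoorClass_of_isTypeIAncientMild)
open Summit.NavierStokesRegularity.NavierStokesRegularity.Theorems.HalfSpaceWindowDoorCirculationCarryingRigidityHorizontalVorticityFloor
  (tendsto_curl_of_tendsto_fderiv)
open Summit.NavierStokesRegularity.NavierStokesRegularity.Theorems.PoloidalWindowDoorPoloidalWindowRigidityWindow
  (isTypeIAncientMild_of_class)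
open Summit.NavierStokesRegularity.NavierStokesRegularity.Theorems.HalfSpaceWindowDoorCirculationCarryingRigidityCriticalStretchingAnalytic
  (inner_curl_e3_eq_zero_of_far_past)
open Summit.NavierStokesRegularity.NavierStokesRegularity.Theorems.HalfSpaceWindowDoorCirculationCarryingRigidityTransportRigidity
  (circ_eq_zero_of_saturated_plane inner_curl_e3_eq_zero_of_circ_nonpos)
open Summit.NavierStokesRegularity.NavierStokesRegularity.Theorems.HalfSpaceWindowDoorCirculationCarryingRigidityConeLiouville
  (circ_zoom_axis)
open Summit.NavierStokesRegularity.NavierStokesRegularity.Theorems.HalfSpaceWindowDoorCirculationCarryingRigidityMovingFrame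
  (inDoorClass_translate signE3_translate)
open Summit.NavierStokesRegularity.NavierStokesRegularity.Theorems.FilamentPinchDoorFilamentPinchLiouvilleFarFieldFlux
  (curl_comp_add_right)

variable {C : ℝ} {v : ℝ → EuclideanSpace ℝ (Fin 3) → EuclideanSpace ℝ (Fin 3)}

/-- **Zooms commute with the moving frame**: the parabolic zoom about the axis point `(0,0,ζ)` of the moving profile is the moving
profile of the zoom. -/
theorem zoom_moving (v : ℝ → EuclideanSpace ℝ (Fin 3) → EuclideanSpace ℝ (Fin 3)) (y₀ : EuclideanSpace ℝ (Fin 3)) {c : ℝ}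
    (hc : 0 ≤ c) (ζ : ℝ) :
    c • stPull (c ^ 2) c 0 (cylPt 0 0 ζ) (fun τ x => v τ (x + Real.sqrt (-τ) • y₀)) =
      fun s y => (c • stPull (c ^ 2) c 0 (cylPt 0 0 ζ) v) s (y + Real.sqrt (-s) • y₀) := by
  funext s y
  simp only [Pi.smul_apply, stPull_apply]
  have hsq : Real.sqrt (-(0 + c ^ 2 * s)) = c * Real.sqrt (-s) := by
    rw [zero_add, show -(c ^ 2 * s) = c ^ 2 * (-s) by ring, Real.sqrt_mul (sq_nonneg c), Real.sqrt_sq hc]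
  rw [hsq, smul_add, smul_smul, add_assoc]

/-- **PARABOLIC CONFINEMENT ABOUT A MOVING AXIS ⇒ POLOIDAL.**  For a closed-hemisphere door-class `v` and `y₀ ∈ ℝ³`, with
`W(t,x) = v(t, x + √(−t)y₀)`: if for `s ≤ σ₀` all disc circulations of `W` are `≤ S₀` and `S₀` is approached by the tube-boundary discs
`D(R₁√(−s), z)`, `s ≤ σ₀`, then `⟪curl v, e₃⟫ ≡ 0` on the slab. -/
theorem inner_curl_e3_eq_zero_of_confined_moving (hv : InDoorClass C v) (hsign : SignE3 v) (y₀ : EuclideanSpace ℝ (Fin 3))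
    {R₁ : ℝ} (hR₁ : 0 ≤ R₁) {σ₀ : ℝ} (hσ₀ : σ₀ < 0) {S₀ : ℝ}
    (hle : ∀ s : ℝ, s ≤ σ₀ → ∀ r : ℝ, 0 ≤ r → ∀ z : ℝ, circ (fun τ x => v τ (x + Real.sqrt (-τ) • y₀)) r z s ≤ S₀)
    (hnear : ∀ ε : ℝ, 0 < ε → ∃ s : ℝ, s ≤ σ₀ ∧ ∃ z : ℝ,
      S₀ - ε < circ (fun τ x => v τ (x + Real.sqrt (-τ) • y₀)) (R₁ * Real.sqrt (-s)) z s) :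
    ∀ s < 0, ∀ y, ⟪curl (v s) y, e3⟫ = 0 := by
  set Wm : ℝ → EuclideanSpace ℝ (Fin 3) → EuclideanSpace ℝ (Fin 3) := fun τ x => v τ (x + Real.sqrt (-τ) • y₀) with hWm
  have hA : IsTypeIAncientMild C v := isTypeIAncientMild_of_class hv.1 hv.2.1 hv.2.2.1 hv.2.2.2
  have hm1 : (-1 : ℝ) < 0 := by norm_num
  rcases le_or_gt S₀ 0 with hS | hS
  · -- the far past is poloidal (slice by slice, through the fixed translate), hence the whole slab
    have hpast : ∀ τ < σ₀, ∀ y, ⟪curl (v τ) y, e3⟫ = 0 := by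
      intro τ hτ y
      have hτ0 : τ < 0 := hτ.trans hσ₀
      have hwc := inDoorClass_translate hv (Real.sqrt (-τ) • y₀)
      have hsc := signE3_translate hsign (Real.sqrt (-τ) • y₀)
      have h0 := inner_curl_e3_eq_zero_of_circ_nonpos hwc hsc hτ0
        (fun r hr z => ((hle τ hτ.le r hr z).trans hS : circ Wm r z τ ≤ 0)) (y - Real.sqrt (-τ) • y₀)
      have e : curl ((fun s x => v s (x + Real.sqrt (-τ) • y₀)) τ) (y - Real.sqrt (-τ) • y₀) =
          curl (v τ) (y - Real.sqrt (-τ) • y₀ + Real.sqrt (-τ) • y₀) := curl_comp_add_right (v τ) _ _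
      rwa [e, sub_add_cancel] at h0
    exact inner_curl_e3_eq_zero_of_far_past hv.1 hv.2.1 hv.2.2.1 hσ₀ hpast
  -- `S₀ > 0`: near-maximal tube-boundary discs, zooms (which commute with the moving frame), limit, plane rigidity
  exfalso
  have hnear' : ∀ n : ℕ, ∃ p : ℝ × ℝ, p.1 ≤ σ₀ ∧ S₀ - 1 / ((n : ℝ) + 1) < circ Wm (R₁ * Real.sqrt (-p.1)) p.2 p.1 := by
    intro n
    obtain ⟨s, hs, z, h⟩ := hnear (1 / ((n : ℝ) + 1)) (by positivity)
    exact ⟨(s, z), hs, h⟩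
  choose p hp1 hp2 using hnear'
  set sn : ℕ → ℝ := fun n => (p n).1 with hsn
  set zn : ℕ → ℝ := fun n => (p n).2 with hzn
  have hsn0 : ∀ n, sn n < 0 := fun n => lt_of_le_of_lt (hp1 n) hσ₀
  set lam : ℕ → ℝ := fun n => Real.sqrt (-sn n) with hlam
  have hlam0 : ∀ n, 0 < lam n := fun n => Real.sqrt_pos.2 (neg_pos.2 (hsn0 n))
  have hlam2 : ∀ n, lam n ^ 2 = -sn n := fun n => Real.sq_sqrt (neg_pos.2 (hsn0 n)).le
  -- zooms of `v` (door class) and of `W` (their moving-frame views)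
  set u : ℕ → ℝ → EuclideanSpace ℝ (Fin 3) → EuclideanSpace ℝ (Fin 3) :=
    fun n => lam n • stPull (lam n ^ 2) (lam n) 0 (cylPt 0 0 (zn n)) v with hu
  set w : ℕ → ℝ → EuclideanSpace ℝ (Fin 3) → EuclideanSpace ℝ (Fin 3) :=
    fun n => lam n • stPull (lam n ^ 2) (lam n) 0 (cylPt 0 0 (zn n)) Wm with hw
  have hucl : ∀ n, IsTypeIAncientMild C (u n) := fun n => isTypeIAncientMild_zoom hA (hlam0 n) _
  have hwu : ∀ n, w n = fun s y => u n s (y + Real.sqrt (-s) • y₀) := fun n => zoom_moving v y₀ (hlam0 n).le (zn n)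
  have hwcirc : ∀ n r z s, circ (w n) r z s = circ Wm (lam n * r) (zn n + lam n * z) (lam n ^ 2 * s) := fun n r z s =>
    circ_zoom_axis (lam n) (zn n) Wm r z s
  have hwR₁ : ∀ n, circ (w n) R₁ 0 (-1) = circ Wm (R₁ * Real.sqrt (-sn n)) (zn n) (sn n) := by
    intro n
    rw [hwcirc, mul_zero, add_zero, hlam2, mul_comm (lam n) R₁]
    congr 1
    ring
  have hwle1 : ∀ n, ∀ r : ℝ, 0 ≤ r → ∀ z, circ (w n) r z (-1) ≤ S₀ := by
    intro n r hr z
    rw [hwcirc, show lam n ^ 2 * (-1 : ℝ) = sn n by rw [hlam2]; ring]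
    exact hle _ (hp1 n) _ (mul_nonneg (hlam0 n).le hr) _
  have husign : ∀ n, SignE3 (u n) := by
    intro n σ hσ y
    have hcurl : curl (u n σ) y =
        (lam n * lam n) • curl (v (0 + lam n ^ 2 * σ)) (cylPt 0 0 (zn n) + lam n • y) :=
      curl_smul_stPull (lam n) (lam n ^ 2) (lam n) 0 (cylPt 0 0 (zn n)) v σ y
    rw [hcurl, real_inner_smul_left]
    refine mul_nonneg (mul_self_nonneg _) (hsign _ ?_ _)
    rw [zero_add]; exact mul_neg_of_pos_of_neg (pow_pos (hlam0 n) 2) hσ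
  obtain ⟨φ, hφ, U, hU, hpt, hptG, hlu, hluG⟩ := exists_tendsto_of_isTypeIAncientMild_seq C hucl
  have hUdoor : InDoorClass C U := inDoorClass_of_isTypeIAncientMild hU
  have hUsign : SignE3 U := by
    intro σ hσ y
    have hc : Tendsto (fun j => ⟪curl (u (φ j) σ) y, e3⟫) atTop (𝓝 ⟪curl (U σ) y, e3⟫) :=
      (tendsto_curl_of_tendsto_fderiv (hptG σ hσ y)).inner tendsto_const_nhds
    exact ge_of_tendsto' hc fun j => husign (φ j) σ hσ y
  -- the moving-frame view of the limit and the convergence of the circulations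
  set WU : ℝ → EuclideanSpace ℝ (Fin 3) → EuclideanSpace ℝ (Fin 3) := fun τ x => U τ (x + Real.sqrt (-τ) • y₀) with hWU
  have hclim : ∀ σ < 0, ∀ r z, Tendsto (fun j => circ (w (φ j)) r z σ) atTop (𝓝 (circ WU r z σ)) := by
    intro σ hσ r z
    have hshift : Continuous fun y : EuclideanSpace ℝ (Fin 3) => y + Real.sqrt (-σ) • y₀ := continuous_id.add continuous_const
    have hlu' : TendstoLocallyUniformly (fun j => w (φ j) σ) (WU σ) atTop := by
      have h := (hlu σ hσ).comp (fun y : EuclideanSpace ℝ (Fin 3) => y + Real.sqrt (-σ) • y₀) hshift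
      refine h.congr (fun j => ?_)
      intro y
      show (u (φ j) σ ∘ fun y => y + Real.sqrt (-σ) • y₀) y = w (φ j) σ y
      rw [hwu]; rfl
    have hcw : ∀ j, Continuous (w (φ j) σ) := fun j => by
      rw [hwu]; exact ((hucl (φ j)).continuous_slice hσ).comp hshift
    have hcW : Continuous (WU σ) := (hU.continuous_slice hσ).comp hshift
    exact tendsto_circ hcw hcW hlu' r z
  have hWR₁ : circ WU R₁ 0 (-1) = S₀ := by
    refine tendsto_nhds_unique (hclim (-1) hm1 R₁ 0) ?_
    have hlow : Tendsto (fun j => S₀ - 1 / ((φ j : ℝ) + 1)) atTop (𝓝 S₀) := by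
      have h1 : Tendsto (fun j => 1 / ((φ j : ℝ) + 1)) atTop (𝓝 0) := by
        have hφ' : Tendsto (fun j => ((φ j : ℕ) : ℝ)) atTop atTop :=
          tendsto_natCast_atTop_atTop.comp hφ.tendsto_atTop
        have : Tendsto (fun j => ((φ j : ℝ) + 1)) atTop atTop := tendsto_atTop_add_const_right _ 1 hφ'
        exact tendsto_const_nhds.div_atTop this
      simpa using tendsto_const_nhds.sub h1
    refine tendsto_of_tendsto_of_tendsto_of_le_of_le hlow tendsto_const_nhds (fun j => ?_) fun j => ?_
    · rw [hwR₁]; exact (hp2 (φ j)).le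
    · exact hwle1 (φ j) R₁ hR₁ 0
  have hWle : ∀ r : ℝ, 0 ≤ r → ∀ z, circ WU r z (-1) ≤ S₀ := fun r hr z =>
    le_of_tendsto' (hclim (-1) hm1 r z) fun j => hwle1 (φ j) r hr z
  -- at time `−1` the moving-frame view is a FIXED translate of the door-class limit: plane saturation rigidity
  have hUt := inDoorClass_translate hUdoor (Real.sqrt (-(-1 : ℝ)) • y₀)
  have hUts := signE3_translate hUsign (Real.sqrt (-(-1 : ℝ)) • y₀)
  have hsat : circ (fun s x => U s (x + Real.sqrt (-(-1 : ℝ)) • y₀)) R₁ 0 (-1) = S₀ := hWR₁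
  have hle' : ∀ r : ℝ, 0 ≤ r → circ (fun s x => U s (x + Real.sqrt (-(-1 : ℝ)) • y₀)) r 0 (-1) ≤ S₀ := fun r hr => hWle r hr 0
  have h0 := circ_eq_zero_of_saturated_plane hUt hUts hm1 hR₁ hsat hle' R₁
  have : S₀ = 0 := by rw [← hsat]; exact h0
  linarith

end Summit.NavierStokesRegularity.NavierStokesRegularity.Theorems.HalfSpaceWindowDoorCirculationCarryingRigidityMovingConfinement

end
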